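import Summits.CriticalPhenomena.PercolationContinuityZ3.Theorems.PercNearOneGluingNoHeavyLowerTailSahiCTCRtThreeExchangeInduction
import Summits.CriticalPhenomena.PercolationContinuityZ3.Theorems.PercNearOneGluingNoHeavyLowerTailSahiCTCRtThreeSignedForm
import HarnessLib

/-!
# `NoHeavyLowerTail` (crux stmt-CriticalPhenomena-4575), P3 lane: `R_3` VANISHES ON SUPPORTS OF SIZE `≤ 2`, and the HYBRID REDUCTION —
# `R_3 ∈ ℕ[s]` for all pairs follows from the exchange monotonicity at `≤ 1` doubled point, ROW 2 with loop-free single points, and the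
# three-point diagonal

Support file (seat `prim-l12-p3`, gen 46; `--supports stmt-CriticalPhenomena-4575`).  Memo
`run/shared/lean/prim/prim-l12/FROM-prim-l12-p3-g46-SIGNED-FORM-AND-EX-REFUTED.md` §4b.

Gen 46 refuted the exchange monotonicity (EX) of gen 45 at profiles with TWO doubled points, while a targeted annealer (kit j294462, 9.2·10⁸ states,
`n = 6..9`) found no violation at profiles with at most ONE doubled point.  This file records the resulting architecture:
* `coeff_Rt_three_eq_zero_of_card_support_le_two` : **`coeff_n R_3(𝒳,𝒵) = 0` whenever `#supp n ≤ 2`** (all profiles, all families): on such supports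
  the large common members never appear and `Θ₂·X·Z` and `Π·X_{≤2}·Z_{≤2}` have the same coefficient;
* **`coeff_Rt_three_nonneg_of_exchangeOne_rowTwo`** : for every pair of up-sets on `α`, `R_3 ∈ ℕ[s]` follows from
  (hEX1) the exchange monotonicity `coeff_{n−e_u+e_s} R_3 ≤ coeff_n R_3` at profiles with entries `≤ 2`, AT MOST ONE doubled point and loop-free single
  points; (hR2) nonnegativity at profiles with entries `≤ 2`, EXACTLY TWO doubled points, at least one single point and loop-free single points (ROW 2 —
  the row where (EX), (Q*), (ML), (MD) all fail and the crux of the lane); (hB3) the three-point diagonal (entries in `{0,2}`, exactly three doubled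
  points; a check on `20²` patterns).  Induction on the number of single points: entries `≥ 3`, `≥ 4` doubled points, the drop at `3` doubled points and the
  loop peel are tree theorems, supports of size `≤ 2` vanish by the first theorem.
Nothing is asserted about the crux; (hEX1), (hR2), (hB3) are NOT proved here.
-/

noncomputable section

open scoped Classical

namespace Summit.CriticalPhenomena.PercolationContinuityZ3.Theorems.SahiCTCForms

open Finset MvPolynomial SahiCTCGenFun

variable {α : Type*} [DecidableEq α] [Fintype α]

/-! ### `R_3` vanishes on supports of size `≤ 2` -/

section SmallSupport
variable (F G : Finset (Finset α)) {n : α →₀ ℕ}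

omit [Fintype α] in
/-- A family of sets of size `≥ 3` has no monomial on a support of size `≤ 2`. [this work] -/
theorem coeff_gf_atLeast_three_eq_zero (K : Finset (Finset α)) (hn : #n.support ≤ 2) {m : α →₀ ℕ} (hm : m ≤ n) :
    (gf (atLeast 3 K)).coeff m = 0 := by
  rw [coeff_gf, Nat.cast_eq_zero, card_eq_zero]
  refine filter_eq_empty_iff.2 fun S hS h => ?_
  have hS3 : 3 ≤ #S := (mem_filter.1 hS).2
  have hsub : S ⊆ n.support := by
    rw [← SahiAllButC.ind_le_iff_subset_support]; rw [h]; exact hm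
  have := card_le_card hsub
  omega

/-- `coeff_n (Θ₂·(Π·GF((𝒳∩𝒵)_{≥3}))) = 0` when `#supp n ≤ 2`. [this work] -/
theorem coeff_Theta_PiP_atLeast_eq_zero (hn : #n.support ≤ 2) :
    (gf (bySize (· < 3) : Finset (Finset α)) * (PiP * gf (atLeast 3 (F ∩ G)))).coeff n = 0 := by
  rw [coeff_gf_mul]
  refine sum_eq_zero fun S _ => ?_
  unfold PiP
  rw [coeff_gf_mul]
  refine sum_eq_zero fun T _ => coeff_gf_atLeast_three_eq_zero _ hn ?_
  exact (tsub_le_self).trans tsub_le_self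

omit [Fintype α] in
/-- On a support of size `≤ 2` only the members of size `≤ 2` of a family are seen by a product coefficient. [this work] -/
theorem coeff_gf_mul_gf_eq_below (hn : #n.support ≤ 2) {m : α →₀ ℕ} (hm : m ≤ n) :
    (gf F * gf G).coeff m = (gf (below 3 F) * gf (below 3 G)).coeff m := by
  rw [coeff_gf_mul_gf, coeff_gf_mul_gf]
  congr 2
  ext PQ
  simp only [mem_filter, mem_product, below]
  have key : ∀ {P Q : Finset α}, ind P + ind Q = m → #P < 3 ∧ #Q < 3 := fun {P Q} h => by
    have hP : ind P ≤ n := (le_trans le_self_add (le_of_eq h)).trans hm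
    have hQ : ind Q ≤ n := (le_trans le_add_self (le_of_eq h)).trans hm
    rw [SahiAllButC.ind_le_iff_subset_support] at hP hQ
    have := card_le_card hP; have := card_le_card hQ
    exact ⟨by omega, by omega⟩
  constructor
  · rintro ⟨⟨hP, hQ⟩, h⟩; exact ⟨⟨⟨hP, (key h).1⟩, hQ, (key h).2⟩, h⟩
  · rintro ⟨⟨⟨hP, -⟩, hQ, -⟩, h⟩; exact ⟨⟨hP, hQ⟩, h⟩

/-- `coeff_n (Θ₂·X·Z) = coeff_n (Π·X_{≤2}·Z_{≤2})` when `#supp n ≤ 2`. [this work] -/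
theorem coeff_Theta_mul_eq_PiP_below (hn : #n.support ≤ 2) :
    (gf (bySize (· < 3) : Finset (Finset α)) * (gf F * gf G)).coeff n = (PiP * (gf (below 3 F) * gf (below 3 G))).coeff n := by
  unfold PiP
  rw [coeff_gf_mul, coeff_gf_mul]
  have hidx : ((bySize (· < 3) : Finset (Finset α)).filter fun S => ind S ≤ n) =
      (univ.powerset : Finset (Finset α)).filter fun S => ind S ≤ n := by
    ext S
    simp only [bySize, mem_filter, mem_powerset, subset_univ, true_and, and_iff_right_iff_imp]
    intro h
    rw [SahiAllButC.ind_le_iff_subset_support] at h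
    have := card_le_card h; omega
  rw [hidx]
  exact sum_congr rfl fun S _ => coeff_gf_mul_gf_eq_below F G hn tsub_le_self

/-- **`coeff_n R_3(𝒳,𝒵) = 0` whenever the support of `n` has at most two points** (any families, any multiplicities). [this work] -/
theorem coeff_Rt_three_eq_zero_of_card_support_le_two (hn : #n.support ≤ 2) : (Rt 3 F G).coeff n = 0 := by
  unfold Rt
  rw [mul_sub, coeff_add, coeff_sub, coeff_Theta_PiP_atLeast_eq_zero F G hn, coeff_Theta_mul_eq_PiP_below F G hn]
  ring

end SmallSupport

/-! ### Supports and single points -/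

omit [Fintype α] in
/-- With entries `≤ 2` the support splits into doubled and single points. [this work] -/
theorem card_support_eq_card_dbl_add (n : α →₀ ℕ) (h2 : ∀ i, n i ≤ 2) :
    #n.support = #(dbl n) + #(n.support.filter fun i => n i = 1) := by
  unfold dbl
  rw [← card_union_of_disjoint]
  · congr 1; ext i
    simp only [mem_union, mem_filter, Finsupp.mem_support_iff]
    constructor
    · intro h; have := h2 i; omega
    · rintro (⟨h, -⟩ | ⟨h, -⟩) <;> exact h
  · exact disjoint_left.2 fun i h1 h2' => by rw [mem_filter] at h1 h2'; omega

/-! ### The hybrid reduction -/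

/-- **`R_3 ∈ ℕ[s]` FROM (EX) AT `≤ 1` DOUBLED POINT, ROW 2 AND THE THREE-POINT DIAGONAL.**  If for all pairs of up-sets on `α`: (hEX1) the exchange
monotonicity holds at profiles with entries `≤ 2`, at most one doubled point and loop-free single points; (hR2) the coefficient is `≥ 0` at profiles
with entries `≤ 2`, exactly two doubled points, at least one single point and loop-free single points; (hB3) the coefficient is `≥ 0` at profiles with
entries in `{0,2}` and exactly three doubled points — then `R_3(𝒳,𝒵) ∈ ℕ[s]` for every pair of up-sets `𝒳, 𝒵` on `α` (memo g46 §4b). [this work] -/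
theorem coeff_Rt_three_nonneg_of_exchangeOne_rowTwo
    (hEX1 : ∀ (F G : Finset (Finset α)), IsUpperSet (F : Set (Finset α)) → IsUpperSet (G : Set (Finset α)) →
      ∀ (n : α →₀ ℕ) (s u : α), s ≠ u → n s = 1 → n u = 1 → (∀ i, n i ≤ 2) → #(dbl n) ≤ 1 →
        (∀ w, n w = 1 → ({w} : Finset α) ∉ F ∧ ({w} : Finset α) ∉ G) →
        (Rt 3 F G).coeff (n - Finsupp.single u 1 + Finsupp.single s 1) ≤ (Rt 3 F G).coeff n)
    (hR2 : ∀ (F G : Finset (Finset α)), IsUpperSet (F : Set (Finset α)) → IsUpperSet (G : Set (Finset α)) →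
      ∀ (n : α →₀ ℕ), (∀ i, n i ≤ 2) → #(dbl n) = 2 → (∃ s, n s = 1) →
        (∀ w, n w = 1 → ({w} : Finset α) ∉ F ∧ ({w} : Finset α) ∉ G) → 0 ≤ (Rt 3 F G).coeff n)
    (hB3 : ∀ (F G : Finset (Finset α)), IsUpperSet (F : Set (Finset α)) → IsUpperSet (G : Set (Finset α)) →
      ∀ (n : α →₀ ℕ), (∀ i, n i = 0 ∨ n i = 2) → #(dbl n) = 3 → 0 ≤ (Rt 3 F G).coeff n)
    {F G : Finset (Finset α)} (hF : IsUpperSet (F : Set (Finset α))) (hG : IsUpperSet (G : Set (Finset α))) (n : α →₀ ℕ) :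
    0 ≤ (Rt 3 F G).coeff n := by
  -- strong induction on the number of single points, for all pairs of up-sets simultaneously
  suffices key : ∀ k : ℕ, ∀ (F G : Finset (Finset α)), IsUpperSet (F : Set (Finset α)) → IsUpperSet (G : Set (Finset α)) →
      ∀ n : α →₀ ℕ, #(n.support.filter fun i => n i = 1) = k → 0 ≤ (Rt 3 F G).coeff n from key _ F G hF hG n rfl
  intro k
  induction k using Nat.strong_induction_on with
  | _ k ih =>
  intro F G hF hG n hk
  -- an entry ≥ 3: unconditional
  by_cases h3 : ∃ w, 3 ≤ n w
  · obtain ⟨w, hw⟩ := h3; exact coeff_Rt_three_nonneg_of_three_le hF hG hw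
  have h2 : ∀ i, n i ≤ 2 := fun i => by by_contra h; exact h3 ⟨i, by omega⟩
  -- four doubled points: unconditional
  by_cases h4 : 4 ≤ #(dbl n)
  · exact coeff_Rt_three_nonneg_of_four_le_card_dbl hF hG h4
  -- supports of size ≤ 2 vanish
  by_cases hsupp : #n.support ≤ 2
  · rw [coeff_Rt_three_eq_zero_of_card_support_le_two F G hsupp]
  have hsupp' : 3 ≤ #(dbl n) + k := by rw [← hk, ← card_support_eq_card_dbl_add n h2]; omega
  -- no single point: the three-point diagonal
  by_cases h0 : #(n.support.filter fun i => n i = 1) = 0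
  · exact hB3 F G hF hG n (eq_zero_or_two_of_ones_eq_zero h2 h0) (by omega)
  obtain ⟨s, hs⟩ := exists_single_of_ones_ne_zero h0
  have ihDown : ∀ {t : α}, n t = 1 → 0 ≤ (Rt 3 F G).coeff (n - Finsupp.single t 1) := fun {t} ht =>
    ih _ (by rw [← hk, ← ones_tsub_single ht]; omega) F G hF hG _ rfl
  have ihUp : ∀ {t : α}, n t = 1 → 0 ≤ (Rt 3 F G).coeff (n + Finsupp.single t 1) := fun {t} ht =>
    ih _ (by rw [← hk, ← ones_add_single ht]; omega) F G hF hG _ rfl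
  -- three doubled points: drop `s`
  by_cases hd3 : 3 ≤ #(dbl n)
  · exact (ihDown hs).trans (coeff_Rt_three_drop_of_three_le_card_dbl hF hG hs hd3)
  -- a single point that is a loop of either family: loop peel
  by_cases hloop : ∃ t, n t = 1 ∧ (({t} : Finset α) ∈ F ∨ ({t} : Finset α) ∈ G)
  · obtain ⟨t, ht, htl⟩ := hloop
    set m := n - Finsupp.single t 1 with hm
    have hmt : m t = 0 := by rw [hm, Finsupp.tsub_apply, Finsupp.single_eq_same, ht]
    have hn : n = m + Finsupp.single t 1 := by rw [hm, tsub_add_cancel_of_le]; rw [Finsupp.single_le_iff, ht]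
    have hpeel : (Rt 3 F G).coeff (m + Finsupp.single t 2) + (Rt 3 F G).coeff m ≤ (Rt 3 F G).coeff (m + Finsupp.single t 1) := by
      rcases htl with h | h
      · exact coeff_Rt_three_loopPeel hF hG h hmt
      · exact coeff_Rt_three_loopPeel' hF hG h hmt
    have hup : n + Finsupp.single t 1 = m + Finsupp.single t 2 := by rw [hn, add_assoc, ← Finsupp.single_add]
    have h1 := ihUp ht
    have h0' := ihDown ht
    rw [hup] at h1; rw [← hm] at h0'; rw [hn]
    linarith
  have hnoloop : ∀ w, n w = 1 → ({w} : Finset α) ∉ F ∧ ({w} : Finset α) ∉ G := fun w hw =>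
    ⟨fun h => hloop ⟨w, hw, Or.inl h⟩, fun h => hloop ⟨w, hw, Or.inr h⟩⟩
  -- exactly two doubled points: row 2
  by_cases hd2 : #(dbl n) = 2
  · exact hR2 F G hF hG n h2 hd2 ⟨s, hs⟩ hnoloop
  have hd1 : #(dbl n) ≤ 1 := by omega
  -- at most one doubled point: at least two single points (support ≥ 3), exchange
  obtain ⟨t, u, htu, ht, hu⟩ := exists_two_singles (n := n) (by omega)
  have hlt : #((n - Finsupp.single u 1 + Finsupp.single t 1).support.filter
      fun i => (n - Finsupp.single u 1 + Finsupp.single t 1 : α →₀ ℕ) i = 1) < k := by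
    rw [← hk, ← ones_exchange htu ht hu]; omega
  exact (ih _ hlt F G hF hG _ rfl).trans (hEX1 F G hF hG n t u htu ht hu h2 hd1 hnoloop)

end Summit.CriticalPhenomena.PercolationContinuityZ3.Theorems.SahiCTCForms
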